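import Mathlib
import Literature.NumberTheory.Sieve.BatemanHornProofs
import Summits.Parity.BatemanHorn.Theorems.IsogenyRedeiPolyMobiusTailStubEventuallyTwoLe
import Summits.Parity.BatemanHorn.Theorems.PolyMobiusTail.Negative.Structure
import Literature.NumberTheory.LFunctions.PolynomialRootMoebiusShortInterval
import Literature.NumberTheory.Sieve.AsymptoticSieveForPrimesLogSumIdentity

/-!
# Crux `PolyMobiusTail` (stmt-Parity-0870), line `Sketch` (natural form): stub `stub_strip`, case `k = 1` — file A (periodic bookkeeping, Abel summation)

The registered stub `stub_strip_fin_one` of the lead's skeleton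
`Summits/Parity/BatemanHorn/Cruxes/PolyMobiusTail/Lines/Sketch.lean` (the natural tail of a ONE-member
Bateman–Horn system between the cut-offs `x^{1-η}` and `x/(log x)^4` sums to `o(x)`) is proved in four
files (`…StubStripFinOne{A,B,C,}.lean`, worker of the line lead prover-line-stmt-Parity-0870-0); the
head theorem of each helper file is a registered auxiliary stub (`stub_core_fin_one`, `stub_U_identity`,
`stub_strip_fin_one_raw_bound`) so that it lands under the gate's stub-match rule.  Inputs from the tree:
Landau's theorem for `Σ μ(n)ρ_g(n)/n` in M-form with rate `(log x)^{-2}`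
(`Literature.NumberTheory.LFunctions.abs_sum_moebius_rootCount_div_le`) and the short-interval mass of
`|μρ_g|` (`…MoebiusRootCount.shortInterval_abs_moebius_mul_rootCount_le`).

This file: `D`-periodic sequences against monotone weights by Abel summation (`periodic_weight_abel`),
the swap-and-period estimate `stub_core_fin_one` (registered auxiliary stub), and the Abel step
`abs_sum_Ioc_mul_log_le` turning an M-form bound with rate `(log N)^{-2}` into the log-weighted
difference bound `|Σ_{N₁<n≤N₂} a(n) log n| ≤ 5C/log N₁` (the `S = ∅` kernel for `k = 1`).
-/

open scoped BigOperators
open Filter Finset Polynomial Asymptotics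

namespace Summit.Parity.BatemanHorn.Theorems.PolyMobiusTail.NaturalForm.StripFinOne

open Literature.NumberTheory.Sieve

/-! ### Periodic sequences against monotone weights (Abel summation) -/


/-- Sum of a `D`-periodic sequence over any window of length `D`. [folklore] -/
theorem sum_Ico_add_period {c : ℕ → ℝ} {D : ℕ} (hc : ∀ n, c (n + D) = c n) (t : ℕ) :
    ∑ j ∈ Ico t (t + D), c j = ∑ j ∈ range D, c j := by
  rcases Nat.eq_zero_or_pos D with hD | hD
  · subst hD
    simp
  induction t with
  | zero => rw [zero_add, Finset.range_eq_Ico]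
  | succ t ih =>
    rw [← ih]
    have h1 : ∑ j ∈ Ico (t + 1) (t + 1 + D), c j = (∑ j ∈ Ico (t + 1) (t + D), c j) + c (t + D) := by
      rw [show t + 1 + D = (t + D) + 1 by ring]
      rw [Finset.sum_Ico_succ_top (by omega)]
    have h2 : ∑ j ∈ Ico t (t + D), c j = c t + ∑ j ∈ Ico (t + 1) (t + D), c j := by
      rw [Finset.sum_eq_sum_Ico_succ_bot (by omega)]
    rw [h1, h2, hc t]
    ring

/-- Sum of a `D`-periodic sequence over `q` consecutive periods. [folklore] -/
theorem sum_range_mul_period {c : ℕ → ℝ} {D : ℕ} (hc : ∀ n, c (n + D) = c n) (q : ℕ) :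
    ∑ j ∈ range (q * D), c j = q * ∑ j ∈ range D, c j := by
  induction q with
  | zero => simp
  | succ q ih =>
    rw [Nat.succ_mul, Finset.range_eq_Ico]
    rw [← Finset.sum_Ico_consecutive c (Nat.zero_le (q * D)) (Nat.le_add_right (q * D) D)]
    rw [← Finset.range_eq_Ico, ih, sum_Ico_add_period hc]
    push_cast
    ring

/-- Partial sums of a non-negative `D`-periodic sequence stay within `ρ = Σ_{j<D} c j` of the linear
function `t ρ / D`. [folklore] -/
theorem abs_sum_range_sub_le {c : ℕ → ℝ} {D : ℕ} (hD : 0 < D) (hc : ∀ n, c (n + D) = c n)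
    (hc0 : ∀ n, 0 ≤ c n) (t : ℕ) :
    |∑ j ∈ range t, c j - t * ((∑ j ∈ range D, c j) / D)| ≤ ∑ j ∈ range D, c j := by
  set ρ := ∑ j ∈ range D, c j with hρ
  have hρ0 : 0 ≤ ρ := Finset.sum_nonneg fun j _ => hc0 j
  obtain ⟨q, s, hs, rfl⟩ : ∃ q s, s < D ∧ t = q * D + s :=
    ⟨t / D, t % D, Nat.mod_lt t hD, (Nat.div_add_mod' t D).symm⟩
  have hsplit : ∑ j ∈ range (q * D + s), c j = q * ρ + ∑ j ∈ Ico (q * D) (q * D + s), c j := by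
    rw [Finset.range_eq_Ico, ← Finset.sum_Ico_consecutive c (Nat.zero_le (q * D)) (Nat.le_add_right _ s),
      ← Finset.range_eq_Ico, sum_range_mul_period hc]
  have hpart0 : 0 ≤ ∑ j ∈ Ico (q * D) (q * D + s), c j := Finset.sum_nonneg fun j _ => hc0 j
  have hpart1 : ∑ j ∈ Ico (q * D) (q * D + s), c j ≤ ρ := by
    calc ∑ j ∈ Ico (q * D) (q * D + s), c j ≤ ∑ j ∈ Ico (q * D) (q * D + D), c j :=
          Finset.sum_le_sum_of_subset_of_nonneg (Finset.Ico_subset_Ico_right (by omega))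
            fun j _ _ => hc0 j
      _ = ρ := sum_Ico_add_period hc _
  have hDR : (0 : ℝ) < D := by exact_mod_cast hD
  have hlin : ((q * D + s : ℕ) : ℝ) * (ρ / D) = q * ρ + s * (ρ / D) := by
    push_cast
    field_simp
  rw [hsplit, hlin]
  have hs0 : (0 : ℝ) ≤ s * (ρ / D) := by positivity
  have hs1 : (s : ℝ) * (ρ / D) ≤ ρ := by
    rw [← mul_div_assoc, div_le_iff₀ hDR]
    have : (s : ℝ) ≤ D := by exact_mod_cast hs.le
    nlinarith
  rw [abs_le]
  constructor <;> linarith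

/-- **Monotone weight against a periodic sequence** (Abel summation form): for `W ≥ 0` non-decreasing
on `[a, b]` (`a ≤ b`), `c ≥ 0` `D`-periodic with `ρ = Σ_{j<D} c j`,
`|Σ_{a≤n≤b} W(n) c(n) − (ρ/D) Σ_{a≤n≤b} W(n)| ≤ 2 ρ W(b)`. [folklore] -/
theorem periodic_weight_abel (W c : ℕ → ℝ) {a b : ℕ} (hab : a ≤ b) (hW0 : ∀ n, a ≤ n → 0 ≤ W n)
    (hWmono : ∀ m n, a ≤ m → m ≤ n → n ≤ b → W m ≤ W n) {D : ℕ} (hD : 0 < D)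
    (hc : ∀ n, c (n + D) = c n) (hc0 : ∀ n, 0 ≤ c n) :
    |∑ n ∈ Icc a b, W n * c n - (∑ j ∈ range D, c j) / D * ∑ n ∈ Icc a b, W n|
      ≤ 2 * (∑ j ∈ range D, c j) * W b := by
  set ρ := ∑ j ∈ range D, c j with hρ
  set e : ℕ → ℝ := fun n => c n - ρ / D with he
  -- partial sums of `e` from 0 are bounded by ρ
  have hE : ∀ t, |∑ j ∈ range t, e j| ≤ ρ := by
    intro t
    have h : ∑ j ∈ range t, e j = ∑ j ∈ range t, c j - t * (ρ / D) := by
      simp only [he, Finset.sum_sub_distrib, Finset.sum_const, Finset.card_range, nsmul_eq_mul]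
    rw [h]
    exact abs_sum_range_sub_le hD hc hc0 t
  have hρ0 : 0 ≤ ρ := Finset.sum_nonneg fun j _ => hc0 j
  -- rewrite the centred sum
  have hlhs : ∑ n ∈ Icc a b, W n * c n - ρ / D * ∑ n ∈ Icc a b, W n
      = ∑ n ∈ Ico a (b + 1), W n • e n := by
    rw [Finset.mul_sum, ← Finset.sum_sub_distrib, ← Finset.Ico_add_one_right_eq_Icc]
    refine Finset.sum_congr rfl fun n _ => ?_
    simp only [he, smul_eq_mul]
    ring
  rw [hlhs, Finset.sum_Ico_by_parts W e (by omega : a < b + 1)]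
  simp only [add_tsub_cancel_right, smul_eq_mul]
  have hWb : 0 ≤ W b := hW0 b hab
  have hWa : 0 ≤ W a := hW0 a le_rfl
  have h1 : |W b * ∑ i ∈ range (b + 1), e i| ≤ W b * ρ := by
    rw [abs_mul, abs_of_nonneg hWb]
    exact mul_le_mul_of_nonneg_left (hE _) hWb
  have h2 : |W a * ∑ i ∈ range a, e i| ≤ W a * ρ := by
    rw [abs_mul, abs_of_nonneg hWa]
    exact mul_le_mul_of_nonneg_left (hE _) hWa
  have h3 : |∑ i ∈ Ico a b, (W (i + 1) - W i) * ∑ j ∈ range (i + 1), e j| ≤ (W b - W a) * ρ := by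
    calc |∑ i ∈ Ico a b, (W (i + 1) - W i) * ∑ j ∈ range (i + 1), e j|
        ≤ ∑ i ∈ Ico a b, |(W (i + 1) - W i) * ∑ j ∈ range (i + 1), e j| := Finset.abs_sum_le_sum_abs _ _
      _ ≤ ∑ i ∈ Ico a b, (W (i + 1) - W i) * ρ := by
          refine Finset.sum_le_sum fun i hi => ?_
          rw [Finset.mem_Ico] at hi
          have hd : 0 ≤ W (i + 1) - W i := sub_nonneg.mpr (hWmono i (i + 1) hi.1 (Nat.le_succ i) hi.2)
          rw [abs_mul, abs_of_nonneg hd]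
          exact mul_le_mul_of_nonneg_left (hE _) hd
      _ = (W b - W a) * ρ := by
          rw [← Finset.sum_mul, Finset.sum_Ico_sub _ hab]
  have hWab : W a ≤ W b := hWmono a b le_rfl hab le_rfl
  calc |W b * ∑ i ∈ range (b + 1), e i - W a * ∑ i ∈ range a, e i
        - ∑ i ∈ Ico a b, (W (i + 1) - W i) * ∑ j ∈ range (i + 1), e j|
      ≤ |W b * ∑ i ∈ range (b + 1), e i| + |W a * ∑ i ∈ range a, e i|
        + |∑ i ∈ Ico a b, (W (i + 1) - W i) * ∑ j ∈ range (i + 1), e j| := by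
        have ha := abs_sub (W b * ∑ i ∈ range (b + 1), e i - W a * ∑ i ∈ range a, e i)
          (∑ i ∈ Ico a b, (W (i + 1) - W i) * ∑ j ∈ range (i + 1), e j)
        have hb := abs_sub (W b * ∑ i ∈ range (b + 1), e i) (W a * ∑ i ∈ range a, e i)
        linarith
    _ ≤ W b * ρ + W a * ρ + (W b - W a) * ρ := add_le_add (add_le_add h1 h2) h3
    _ = 2 * ρ * W b := by ring


/-- **Swap and period (k = 1).** For a weight `W ≥ 0` non-decreasing on `[a, b]`, coefficients `w e`
and a predicate `P e n` that is `e`-periodic in `n`: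
`Σ_{a≤n≤b} W(n) Σ_{e≤Y} w(e) [P e n] = (Σ_{a≤n≤b} W(n)) · Σ_{e≤Y} w(e) ρ_e/e + O(2 W(b) Σ_{e≤Y} |w e| ρ_e)`,
`ρ_e = #{r < e : P e r}`. [folklore] -/
theorem stub_core_fin_one :
    ∀ (W : ℕ → ℝ) (w : ℕ → ℝ) (P : ℕ → ℕ → Prop) [∀ e n, Decidable (P e n)] {a b : ℕ} (hab : a ≤ b) (Y : ℕ) (hW0 : ∀ n, a ≤ n → 0 ≤ W n) (hWmono : ∀ m n, a ≤ m → m ≤ n → n ≤ b → W m ≤ W n) (hP : ∀ e n, P e (n + e) ↔ P e n),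
    |(∑ n ∈ Icc a b, W n * ∑ e ∈ Icc 1 Y, w e * (if P e n then 1 else 0))
      - (∑ n ∈ Icc a b, W n) * ∑ e ∈ Icc 1 Y, w e * ((((range e).filter (P e)).card : ℝ) / e)|
    ≤ 2 * W b * ∑ e ∈ Icc 1 Y, |w e| * (((range e).filter (P e)).card : ℝ) := by
  intro W w P _ a b hab Y hW0 hWmono hP
  have hswap : (∑ n ∈ Icc a b, W n * ∑ e ∈ Icc 1 Y, w e * (if P e n then 1 else 0))
      = ∑ e ∈ Icc 1 Y, w e * ∑ n ∈ Icc a b, W n * (if P e n then 1 else 0) := by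
    simp_rw [Finset.mul_sum]
    rw [Finset.sum_comm]
    refine Finset.sum_congr rfl fun e _ => Finset.sum_congr rfl fun n _ => ?_
    ring
  rw [hswap, Finset.mul_sum, ← Finset.sum_sub_distrib]
  have hρ : ∀ e, (((range e).filter (P e)).card : ℝ) = ∑ j ∈ range e, (if P e j then (1 : ℝ) else 0) := by
    intro e
    rw [Finset.sum_boole]
  calc |∑ e ∈ Icc 1 Y, (w e * ∑ n ∈ Icc a b, W n * (if P e n then 1 else 0)
          - (∑ n ∈ Icc a b, W n) * (w e * ((((range e).filter (P e)).card : ℝ) / e)))|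
      ≤ ∑ e ∈ Icc 1 Y, |w e * ∑ n ∈ Icc a b, W n * (if P e n then 1 else 0)
          - (∑ n ∈ Icc a b, W n) * (w e * ((((range e).filter (P e)).card : ℝ) / e))| :=
        Finset.abs_sum_le_sum_abs _ _
    _ ≤ ∑ e ∈ Icc 1 Y, 2 * W b * (|w e| * (((range e).filter (P e)).card : ℝ)) := by
        refine Finset.sum_le_sum fun e he => ?_
        have he1 : 0 < e := (Finset.mem_Icc.mp he).1
        have hper : ∀ n, (fun n => if P e n then (1 : ℝ) else 0) (n + e)
            = (fun n => if P e n then (1 : ℝ) else 0) n := by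
          intro n
          by_cases hn : P e n
          · simp only [if_pos hn, if_pos ((hP e n).mpr hn)]
          · simp only [if_neg hn, if_neg (fun h => hn ((hP e n).mp h))]
        have hc0 : ∀ n, 0 ≤ (fun n => if P e n then (1 : ℝ) else 0) n := by
          intro n
          by_cases hn : P e n
          · simp only [if_pos hn]; norm_num
          · simp only [if_neg hn]; norm_num
        have key := periodic_weight_abel W (fun n => if P e n then (1 : ℝ) else 0) hab hW0 hWmono he1
          hper hc0
        rw [← hρ e] at key
        have h : w e * ∑ n ∈ Icc a b, W n * (if P e n then 1 else 0)
            - (∑ n ∈ Icc a b, W n) * (w e * ((((range e).filter (P e)).card : ℝ) / e))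
            = w e * (∑ n ∈ Icc a b, W n * (if P e n then 1 else 0)
              - (((range e).filter (P e)).card : ℝ) / e * ∑ n ∈ Icc a b, W n) := by ring
        rw [h, abs_mul]
        calc |w e| * |∑ n ∈ Icc a b, W n * (if P e n then 1 else 0)
              - (((range e).filter (P e)).card : ℝ) / e * ∑ n ∈ Icc a b, W n|
            ≤ |w e| * (2 * (((range e).filter (P e)).card : ℝ) * W b) :=
              mul_le_mul_of_nonneg_left key (abs_nonneg _)
          _ = 2 * W b * (|w e| * (((range e).filter (P e)).card : ℝ)) := by ring
    _ = 2 * W b * ∑ e ∈ Icc 1 Y, |w e| * (((range e).filter (P e)).card : ℝ) := by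
        rw [← Finset.mul_sum]


/-! ### Abel summation: the log-weighted difference from the M-form -/


/-- The telescoping majorant `(log(i+1) − log i)/log² i ≤ 2 (1/log i − 1/log(i+1))`, `i ≥ 2`.
[folklore] -/
theorem log_diff_div_sq_le {i : ℕ} (hi : 2 ≤ i) :
    (Real.log ((i : ℝ) + 1) - Real.log i) / Real.log i ^ 2
      ≤ 2 * (1 / Real.log i - 1 / Real.log ((i : ℝ) + 1)) := by
  have hi' : (2 : ℝ) ≤ i := by exact_mod_cast hi
  have hli : 0 < Real.log i := Real.log_pos (by linarith)
  have hli1 : 0 < Real.log ((i : ℝ) + 1) := Real.log_pos (by linarith)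
  have hmono : Real.log i ≤ Real.log ((i : ℝ) + 1) := Real.log_le_log (by linarith) (by linarith)
  have h2 := Literature.NumberTheory.Sieve.log_succ_le_two_mul_log hi
  have hd : 0 ≤ Real.log ((i : ℝ) + 1) - Real.log i := by linarith
  rw [div_le_iff₀ (pow_pos hli 2)]
  have key : 2 * (1 / Real.log i - 1 / Real.log ((i : ℝ) + 1)) * Real.log i ^ 2
      = (Real.log ((i : ℝ) + 1) - Real.log i) * (2 * Real.log i / Real.log ((i : ℝ) + 1)) := by
    field_simp
  rw [key]
  exact le_mul_of_one_le_right hd ((one_le_div hli1).mpr h2)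

/-- **Abel summation step.** If `|Σ_{n≤N} a(n)| ≤ C/log² N` for all `N ≥ 2` (and `a 0 = 0`), then
`|Σ_{N₁<n≤N₂} a(n) log n| ≤ 5C/log N₁` for `2 ≤ N₁ ≤ N₂`. [folklore] -/
theorem abs_sum_Ioc_mul_log_le (a : ℕ → ℝ) {C : ℝ} (hC : 0 ≤ C) (ha0 : a 0 = 0)
    (hA : ∀ N : ℕ, 2 ≤ N → |∑ n ∈ Icc 1 N, a n| ≤ C / Real.log N ^ 2)
    {N₁ N₂ : ℕ} (h2 : 2 ≤ N₁) (h12 : N₁ ≤ N₂) :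
    |∑ n ∈ Ioc N₁ N₂, a n * Real.log n| ≤ 5 * C / Real.log N₁ := by
  have hN₁' : (2 : ℝ) ≤ N₁ := by exact_mod_cast h2
  have hl1 : 0 < Real.log N₁ := Real.log_pos (by linarith)
  rcases h12.eq_or_lt with heq | hlt
  · subst heq
    simp only [Finset.Ioc_self, Finset.sum_empty, abs_zero]
    positivity
  -- partial sums from 0 are the `Icc 1` sums
  have hG : ∀ k, ∑ i ∈ range (k + 1), a i = ∑ n ∈ Icc 1 k, a n := by
    intro k
    rw [Finset.sum_range_succ', ha0, add_zero, ← Finset.Ico_add_one_right_eq_Icc,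
      Finset.sum_Ico_eq_sum_range, Nat.add_sub_cancel]
    exact Finset.sum_congr rfl fun i _ => by rw [add_comm]
  have hAbs : ∀ k, 2 ≤ k → |∑ i ∈ range (k + 1), a i| ≤ C / Real.log k ^ 2 := by
    intro k hk
    rw [hG]
    exact hA k hk
  have hsm : ∑ n ∈ Ioc N₁ N₂, a n * Real.log n = ∑ n ∈ Ioc N₁ N₂, (fun n : ℕ => Real.log n) n • a n :=
    Finset.sum_congr rfl fun n _ => by rw [smul_eq_mul, mul_comm]
  rw [hsm, Finset.sum_Ioc_by_parts (fun n : ℕ => Real.log n) a hlt]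
  simp only [smul_eq_mul]
  -- the three terms
  have hN₂2 : 2 ≤ N₂ := h2.trans h12
  have hN₂' : (2 : ℝ) ≤ N₂ := by exact_mod_cast hN₂2
  have hl2 : 0 < Real.log N₂ := Real.log_pos (by linarith)
  have hl12 : Real.log N₁ ≤ Real.log N₂ := Real.log_le_log (by linarith) (by exact_mod_cast h12)
  have hT1 : |Real.log N₂ * ∑ i ∈ range (N₂ + 1), a i| ≤ C / Real.log N₁ := by
    rw [abs_mul, abs_of_pos hl2]
    calc Real.log N₂ * |∑ i ∈ range (N₂ + 1), a i| ≤ Real.log N₂ * (C / Real.log N₂ ^ 2) :=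
          mul_le_mul_of_nonneg_left (hAbs N₂ hN₂2) hl2.le
      _ = C / Real.log N₂ := by field_simp
      _ ≤ C / Real.log N₁ := div_le_div_of_nonneg_left hC hl1 hl12
  have hT2 : |Real.log ((N₁ + 1 : ℕ) : ℝ) * ∑ i ∈ range (N₁ + 1), a i| ≤ 2 * C / Real.log N₁ := by
    have hl : 0 < Real.log ((N₁ + 1 : ℕ) : ℝ) := Real.log_pos (by push_cast; linarith)
    rw [abs_mul, abs_of_pos hl]
    calc Real.log ((N₁ + 1 : ℕ) : ℝ) * |∑ i ∈ range (N₁ + 1), a i|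
        ≤ (2 * Real.log N₁) * (C / Real.log N₁ ^ 2) := by
          refine mul_le_mul ?_ (hAbs N₁ h2) (abs_nonneg _) (by positivity)
          push_cast
          exact Literature.NumberTheory.Sieve.log_succ_le_two_mul_log h2
      _ = 2 * C / Real.log N₁ := by field_simp
  have hT3 : |∑ i ∈ Ioc N₁ (N₂ - 1), (Real.log ((i + 1 : ℕ) : ℝ) - Real.log i) * ∑ j ∈ range (i + 1), a j|
      ≤ 2 * C / Real.log N₁ := by
    calc |∑ i ∈ Ioc N₁ (N₂ - 1), (Real.log ((i + 1 : ℕ) : ℝ) - Real.log i) * ∑ j ∈ range (i + 1), a j|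
        ≤ ∑ i ∈ Ioc N₁ (N₂ - 1), |(Real.log ((i + 1 : ℕ) : ℝ) - Real.log i) * ∑ j ∈ range (i + 1), a j| :=
          Finset.abs_sum_le_sum_abs _ _
      _ ≤ ∑ i ∈ Ioc N₁ (N₂ - 1), 2 * C * (1 / Real.log i - 1 / Real.log ((i : ℝ) + 1)) := by
          refine Finset.sum_le_sum fun i hi => ?_
          have hi2 : 2 ≤ i := h2.trans (Finset.mem_Ioc.mp hi).1.le
          have hi' : (2 : ℝ) ≤ i := by exact_mod_cast hi2
          have hd : 0 ≤ Real.log ((i + 1 : ℕ) : ℝ) - Real.log i := by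
            push_cast
            linarith [Real.log_le_log (by linarith : (0 : ℝ) < i) (by linarith : (i : ℝ) ≤ i + 1)]
          rw [abs_mul, abs_of_nonneg hd]
          calc (Real.log ((i + 1 : ℕ) : ℝ) - Real.log i) * |∑ j ∈ range (i + 1), a j|
              ≤ (Real.log ((i + 1 : ℕ) : ℝ) - Real.log i) * (C / Real.log i ^ 2) :=
                mul_le_mul_of_nonneg_left (hAbs i hi2) hd
            _ = C * ((Real.log ((i : ℝ) + 1) - Real.log i) / Real.log i ^ 2) := by
                push_cast
                ring
            _ ≤ C * (2 * (1 / Real.log i - 1 / Real.log ((i : ℝ) + 1))) :=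
                mul_le_mul_of_nonneg_left (log_diff_div_sq_le hi2) hC
            _ = 2 * C * (1 / Real.log i - 1 / Real.log ((i : ℝ) + 1)) := by ring
      _ = 2 * C * (1 / Real.log ((N₁ + 1 : ℕ) : ℝ) - 1 / Real.log N₂) := by
          rw [← Finset.mul_sum]
          congr 1
          have hIoc : Ioc N₁ (N₂ - 1) = Ico (N₁ + 1) N₂ := by
            ext i
            simp only [Finset.mem_Ioc, Finset.mem_Ico]
            omega
          rw [hIoc]
          have htel := Finset.sum_Ico_sub (fun i : ℕ => 1 / Real.log (i : ℝ)) (by omega : N₁ + 1 ≤ N₂)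
          simp only [Nat.cast_add, Nat.cast_one] at htel ⊢
          rw [← neg_sub, ← htel, ← Finset.sum_neg_distrib]
          refine Finset.sum_congr rfl fun i _ => by ring
      _ ≤ 2 * C / Real.log N₁ := by
          have hl : 0 < Real.log ((N₁ + 1 : ℕ) : ℝ) := Real.log_pos (by push_cast; linarith)
          have hmono : Real.log N₁ ≤ Real.log ((N₁ + 1 : ℕ) : ℝ) :=
            Real.log_le_log (by linarith) (by push_cast; linarith)
          have h1 : 1 / Real.log ((N₁ + 1 : ℕ) : ℝ) ≤ 1 / Real.log N₁ :=
            div_le_div_of_nonneg_left zero_le_one hl1 hmono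
          have h2' : 0 ≤ 1 / Real.log (N₂ : ℝ) := by positivity
          calc 2 * C * (1 / Real.log ((N₁ + 1 : ℕ) : ℝ) - 1 / Real.log N₂)
              ≤ 2 * C * (1 / Real.log N₁) := by nlinarith
            _ = 2 * C / Real.log N₁ := by ring
  calc |Real.log N₂ * ∑ i ∈ range (N₂ + 1), a i
        - Real.log ((N₁ + 1 : ℕ) : ℝ) * ∑ i ∈ range (N₁ + 1), a i
        - ∑ i ∈ Ioc N₁ (N₂ - 1), (Real.log ((i + 1 : ℕ) : ℝ) - Real.log i) * ∑ j ∈ range (i + 1), a j|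
      ≤ |Real.log N₂ * ∑ i ∈ range (N₂ + 1), a i|
        + |Real.log ((N₁ + 1 : ℕ) : ℝ) * ∑ i ∈ range (N₁ + 1), a i|
        + |∑ i ∈ Ioc N₁ (N₂ - 1), (Real.log ((i + 1 : ℕ) : ℝ) - Real.log i) * ∑ j ∈ range (i + 1), a j| := by
        have ha := abs_sub (Real.log N₂ * ∑ i ∈ range (N₂ + 1), a i
          - Real.log ((N₁ + 1 : ℕ) : ℝ) * ∑ i ∈ range (N₁ + 1), a i)
          (∑ i ∈ Ioc N₁ (N₂ - 1), (Real.log ((i + 1 : ℕ) : ℝ) - Real.log i) * ∑ j ∈ range (i + 1), a j)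
        have hb := abs_sub (Real.log N₂ * ∑ i ∈ range (N₂ + 1), a i)
          (Real.log ((N₁ + 1 : ℕ) : ℝ) * ∑ i ∈ range (N₁ + 1), a i)
        linarith
    _ ≤ C / Real.log N₁ + 2 * C / Real.log N₁ + 2 * C / Real.log N₁ := add_le_add (add_le_add hT1 hT2) hT3
    _ = 5 * C / Real.log N₁ := by ring

end Summit.Parity.BatemanHorn.Theorems.PolyMobiusTail.NaturalForm.StripFinOne
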